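import Mathlib
import HarnessLib
import Summits.HubbardSuperconductivity.HubbardSuperconductivity.Theorems.KLProgrammeKLRegimeTwoVolumeSectorPreimageMap
import Literature.MathematicalPhysics.QuantumLattice.SectorisedEffectiveActionBoundPlateau
import Literature.MathematicalPhysics.QuantumLattice.GrassmannLinearSubstitution

/-!
# Route `KLProgramme` — crux K3, the nested two-volume pass: ONE SCALE OF THE SECTOR-FIELD TOWER IS «STEP THEN ONE SUBSTITUTION»
# (cell gate-hubbard-kl, seat hubbard-kl-k3c4-p1 g9; blueprint VL-INDUCTION-BLUEPRINT-g9.md §B; `--supports` stmt-…-20440)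

The (A3)/(vi) induction (`…TwoVolumeScaleSucc.twoVolume_scale_succ_le`) needs the sector-field actions of consecutive scales related by
`(input at scale j+1) = map (toLin' T_j) (output at scale j)`.  With the tree's objects — `sectorPreimage β F` (input presentation), the synthesis
`S(F̃) = sectorSubMatrix β F̃`, the analysis `E(F′) = sectorAnalysisMatrix β F′`, a slice covariance `C` supported in the plateau of the thin/fat pair `(F, F̃)`,
and the next family `F′` inside that plateau — this is an IDENTITY of elements:

* **`sectorPreimage_effAction_eq_map_effAction_sectorPreimage`** —
  `sectorPreimage β F′ (effAction C G) = map (toLin' ((ε • E(F′)) · S(F̃))) (effAction (S(F̃)ᵀ C S(F̃)) (sectorPreimage β F G))`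
  (`map_sectorAnalysis_effAction_map_sectorPreimage_of_plateau` ∘ `effAction_map` ∘ `sectorPreimage_eq_map_smul_sectorAnalysis`).  With `G = 𝒱^{(j−1)}`,
  `C = C^K_{(Λ_j, Λ_{j−1}]}` (`klEffectiveAction_succ_eq_effAction_slice`) this reads `Pre_{F_{j+1}} 𝒱^{(j)} = map (toLin' T_j) W^j`,
  `W^j := effAction (S_jᵀ C_j S_j) (Pre_{F_j} 𝒱^{(j−1)})`, `T_j = ε • E(F_{j+1})·S(F̃_j)` — the substitution of `twoVolume_scale_succ_le`.

Model-generic (any families satisfying the plateau hypotheses, any covariance supported in the plateau); everything proved; no definition.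
Reference: BGM 2006 §2.7 (2.70)–(2.71).
-/

noncomputable section

namespace Summit.HubbardSuperconductivity.HubbardSuperconductivity.Theorems.TwoVolumeDefect

set_option linter.dupNamespace false -- summit = problem name (single-conjunct summit), D-0017

open Finset Literature.MathematicalPhysics.QuantumLattice GrassmannAlgebra Literature.Probability.LatticeModels

variable {L M : ℕ} [NeZero L] [NeZero M] {N N' : ℕ}

/-- Scaling the analysis after the fact: `map (toLin' (c • E)) X = map (toLin' (c • 1)) (map (toLin' E) X)`. [folklore] -/
theorem map_toLin'_smul_eq_map_map {Γ Γ' : Type*} [Fintype Γ] [DecidableEq Γ] [Fintype Γ'] [DecidableEq Γ'] (c : ℂ) (E : Matrix Γ' Γ ℂ)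
    (X : GrassmannAlgebra ℂ Γ) :
    ExteriorAlgebra.map (Matrix.toLin' (c • E)) X =
      ExteriorAlgebra.map (Matrix.toLin' (c • (1 : Matrix Γ' Γ' ℂ))) (ExteriorAlgebra.map (Matrix.toLin' E) X) := by
  rw [map_map_eq_map_comp, ← Matrix.toLin'_mul, Matrix.smul_mul, Matrix.one_mul]

/-- **ONE SCALE OF THE SECTOR-FIELD TOWER = STEP THEN ONE SUBSTITUTION.**  For a thin/fat pair `(F, F̃)` (`F̃F = F`, `ΣF = 0 ⇒ F = 0`), a covariance `C` supported in
the plateau `{Σ_ω F_ω = 1}` and a next family `F′` supported there too: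
`sectorPreimage β F′ (effAction C G) = map (toLin' ((ε • E(F′)) · S(F̃))) (effAction (S(F̃)ᵀ C S(F̃)) (sectorPreimage β F G))`.
[cite: BenfattoGiulianiMastropietro2006, §2.7 (2.70)–(2.71)] -/
theorem sectorPreimage_effAction_eq_map_effAction_sectorPreimage {β : ℝ} (hβ : β ≠ 0) (F Ft : Fin N → FreqMomentum L M → ℂ)
    (hFF : ∀ ω k, Ft ω k * F ω k = F ω k) (hF0 : ∀ k, ∑ ω, F ω k = 0 → ∀ ω, F ω k = 0) (F' : Fin N' → FreqMomentum L M → ℂ)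
    (G : HubbardGrassmann L M) (C : Matrix (HubbardFieldIdx L M) (HubbardFieldIdx L M) ℂ)
    (hCpl : ∀ X Y, C X Y ≠ 0 → ∑ ω, F ω X.1.1 = 1 ∧ ∑ ω, F ω Y.1.1 = 1)
    (hF'pl : ∀ (ω' : Fin N') (k : FreqMomentum L M), F' ω' k ≠ 0 → ∑ ω, F ω k = 1) :
    sectorPreimage β F' (effAction ℂ C G) =
      ExteriorAlgebra.map (Matrix.toLin' (((((imagTimeWeight β M : ℝ) : ℂ)) • sectorAnalysisMatrix L M β F') * sectorSubMatrix L M β Ft))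
        (effAction ℂ ((sectorSubMatrix L M β Ft).transpose * C * sectorSubMatrix L M β Ft) (sectorPreimage β F G)) := by
  -- the measured step does not see the plateau rescaling (BGM (2.70)–(2.71)), scaled by `ε`
  have hpl := map_sectorAnalysis_effAction_map_sectorPreimage_of_plateau hβ F Ft hFF hF0 F' G C hCpl hF'pl
  rw [sectorPreimage_eq_map_smul_sectorAnalysis, map_toLin'_smul_eq_map_map, ← hpl, ← map_toLin'_smul_eq_map_map,
    effAction_map, LinearMap.toMatrix'_toLin', map_map_eq_map_comp, ← Matrix.toLin'_mul]

end Summit.HubbardSuperconductivity.HubbardSuperconductivity.Theorems.TwoVolumeDefect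

end
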